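import Mathlib
import HarnessLib
import Summits.Ventures.LatticeQCDFlow.Scaling.AbsoluteMomentCLT
import Summits.Ventures.LatticeQCDFlow.Scaling.CumulantDiagonalLimit
import Summits.Ventures.LatticeQCDFlow.Scoring.IMHLogNormalAcceptance

/-!
# LatticeQCDFlow / Scaling — the DIAGONAL SCALING LIMIT of the untrained factorised sampler:
# at coupling `β = c/√V` its acceptance converges to the LOG-NORMAL acceptance law `erfc(|c|σ/2)`

HONEST FRAMING: exact (Metropolis-corrected) sampling algorithms for lattice gauge theory;
figures of merit are autocorrelation/cost numbers at stated couplings and volumes; no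
continuum-physics claim.

Venture `LatticeQCDFlow` (cell pub-lqcd), topic `Scaling`; FANOUT row 3 (`s0-u1-a`, S0-B
implementation A, GEN-19).  NEW WORK of the cell (assembled on Mathlib's central limit theorem via
row 3's `Scaling/AbsoluteMomentCLT`, Mathlib's `ProbabilityMeasure.continuous_prod`, Hoeffding's lemma
`ProbabilityTheory.mgf_le_of_mem_Icc_of_integral_eq_zero` and the Lagrange form
`exists_cgf_eq_iteratedDeriv_two_cgf_mul` of the cumulant generating function); NO definition is
introduced; nothing is cited.  The limit law is the flow seat's DICTIONARY file
`Scoring/IMHLogNormalAcceptance` (`ā = erfc(σ/2)` for log-normal weights), imported for the closed form.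

## The statement

Blocks: a probability law `ν` on `X` and a BOUNDED centred block statistic `g` (`a ≤ g ≤ b`,
`∫ g dν = 0`, variance `σ²`).  The untrained (identity-flow) exact sampler of the `n`-block tilt
family — proposal `ν^{⊗n}`, target `e^{β T_n} ν^{⊗n}/M(β)^n`, `T_n = Σᵢ g(xᵢ)` — has equilibrium
acceptance (row 3's functional of `Scaling/TiltAcceptanceJensenFloor`, `q = 1`)
`acc_n(β) = (∫∫ min(e^{β T_n(x)}, e^{β T_n(x′)}) dν^{⊗n} dν^{⊗n}) / ∫ e^{β T_n} dν^{⊗n}`.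
GEN-16/17/18 proved: `acc_n(β) → 0` geometrically in `n` at fixed `β ≠ 0`, and
`1 − acc_n(β) ∼ β·s_n`, `s_n ≍ σ√n`, as `β → 0` at fixed `n` (GEN-19: `s_n/√n → σ/√π`).  The two
regimes meet on the DIAGONAL `β√n = c`:

* **`tiltPi_meanAccept_diag_tendsto`** — for every real `c`,
  `acc_n(c/√n) → ∫∫ min(e^x, e^y) dN(−s/2, s)(x) dN(−s/2, s)(y)`, `s = c²σ²` — the stationary
  acceptance of the independence sampler with LOG-NORMAL weights of log-variance `s`
  (`Literature.PseudoMarginalNoise.noiseLaw s = N(−s/2, s)`);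
* **`tiltPi_meanAccept_diag_tendsto_erfc`** — `= (2/√π)∫_{|c|σ/2}^∞ e^{−u²} du = erfc(|c|σ/2)`
  (`c ≠ 0`, `σ ≠ 0`; the dictionary file's `imh_lognormal_accRate_eq_erfc`).

So the scorers' log-normal inversion `σ(ā)` is EXACT in the large-volume limit for the untrained
sampler along `β√V = c` (`Var_q(log w) → c²σ²`): its useful coupling window is `β = Θ(V^{−1/2})`
with the precise profile `erfc(|c|σ/2)`.  Proof (all `[ours]`): §1 weak convergence of laws ⇒ of
product laws (`continuous_prod`) ⇒ convergence of `∫ F d(μₙ⊗μₙ)` for continuous `F` with bounded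
second moments (row 3's `tendsto_integral_abs_of_tendstoInDistribution`); §2 the pair functional
`F = min(e^{cu}, e^{cv})` (second moments `≤ ∫e^{2cu} dμₙ = M(2c/√n)^n ≤ e^{2c²K²}`, Hoeffding, and
the denominator `M(c/√n)^n → e^{c²σ²/2}`: `Scaling/CumulantDiagonalLimit`); §3 `Sₙ = Tₙ/√n ⇒ N(0, σ²)`
(`pi_tendstoInDistribution_inv_sqrt_mul_sum`) and the change of variables `cG − s/2 ∼ N(−s/2, c²σ²)`.

NOT CLAIMED: unbounded `g` (exponential moments would suffice); a rate; the torus; trained flows;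
any value at the cell's `(β, L)`; nothing re-scored.
-/

noncomputable section

namespace Summit.Ventures.LatticeQCDFlow.Theory2

open MeasureTheory ProbabilityTheory Filter Finset Real Set
open scoped Topology NNReal

/-! ## §1 Product laws and second-moment uniform integrability -/

section Plumbing

/-- A continuous statistic read on weakly convergent laws converges in distribution (the identity
statistic, then continuous mapping). [ours] -/
theorem tendstoInDistribution_of_tendsto_measures {E : Type*} [MeasurableSpace E]
    [TopologicalSpace E] [BorelSpace E] {Ps : ℕ → ProbabilityMeasure E} {P : ProbabilityMeasure E}
    (h : Tendsto Ps atTop (𝓝 P)) {F : E → ℝ} (hF : Continuous F) :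
    TendstoInDistribution (fun _ => F) atTop F (fun n => (Ps n : Measure E)) (P : Measure E) := by
  have hid : TendstoInDistribution (fun _ => (id : E → E)) atTop id
      (fun n => (Ps n : Measure E)) (P : Measure E) :=
    { forall_aemeasurable := fun _ => aemeasurable_id
      aemeasurable_limit := aemeasurable_id
      tendsto := by
        simp only [Measure.map_id]
        convert h using 2 <;> exact Subtype.ext rfl }
  exact hid.continuous_comp hF

/-- **Second-moment uniform integrability on product laws**: if `μₙ ⇒ μ` weakly on `ℝ`, `F ≥ 0` is
continuous on `ℝ²` and `∫ F² d(μₙ⊗μₙ) ≤ C`, `∫ F² d(μ⊗μ) ≤ C` (with `F ∈ L²`), then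
`∫ F d(μₙ⊗μₙ) → ∫ F d(μ⊗μ)`. [ours] -/
theorem tendsto_integral_prod_of_tendsto {μs : ℕ → ProbabilityMeasure ℝ} {μ : ProbabilityMeasure ℝ}
    (h : Tendsto μs atTop (𝓝 μ)) {F : ℝ × ℝ → ℝ} (hF : Continuous F) (hF0 : ∀ z, 0 ≤ F z) {C : ℝ}
    (h2 : ∀ n, MemLp F 2 ((μs n : Measure ℝ).prod (μs n)))
    (h2C : ∀ n, ∫ z, F z ^ 2 ∂((μs n : Measure ℝ).prod (μs n)) ≤ C)
    (hZ : MemLp F 2 ((μ : Measure ℝ).prod μ)) (hZC : ∫ z, F z ^ 2 ∂((μ : Measure ℝ).prod μ) ≤ C) :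
    Tendsto (fun n => ∫ z, F z ∂((μs n : Measure ℝ).prod (μs n))) atTop
      (𝓝 (∫ z, F z ∂((μ : Measure ℝ).prod μ))) := by
  -- product laws converge (Mathlib's `ProbabilityMeasure.continuous_prod`), then continuous mapping
  have hdist := tendstoInDistribution_of_tendsto_measures
    ((ProbabilityMeasure.continuous_prod.tendsto (μ, μ)).comp (h.prodMk_nhds h)) hF
  simp only [ProbabilityMeasure.toMeasure_prod] at hdist
  have key := tendsto_integral_abs_of_tendstoInDistribution hdist (C := C) h2 h2C hZ hZC
  simp only [abs_of_nonneg (hF0 _)] at key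
  exact key

end Plumbing

/-! ## §2 The pair functional `min(e^{cu}, e^{cv})` on product laws -/

section PairFunctional

/-- For a law `ρ` on `ℝ` with `e^{cu}, e^{2cu} ∈ L¹(ρ)`: the pair functional
`F(u, v) = min(e^{cu}, e^{cv})` is integrable and square integrable on `ρ ⊗ ρ`, with
`∫ F² d(ρ⊗ρ) ≤ ∫ e^{2cu} dρ`. [ours] -/
theorem min_exp_prod_facts (ρ : Measure ℝ) [IsProbabilityMeasure ρ] (c : ℝ)
    (h1 : Integrable (fun u => Real.exp (c * u)) ρ)
    (h2 : Integrable (fun u => Real.exp (2 * c * u)) ρ) :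
    Integrable (fun z : ℝ × ℝ => min (Real.exp (c * z.1)) (Real.exp (c * z.2))) (ρ.prod ρ)
      ∧ MemLp (fun z : ℝ × ℝ => min (Real.exp (c * z.1)) (Real.exp (c * z.2))) 2 (ρ.prod ρ)
      ∧ ∫ z, (min (Real.exp (c * z.1)) (Real.exp (c * z.2))) ^ 2 ∂(ρ.prod ρ)
          ≤ ∫ u, Real.exp (2 * c * u) ∂ρ := by
  have hFc : Continuous fun z : ℝ × ℝ => min (Real.exp (c * z.1)) (Real.exp (c * z.2)) := by
    fun_prop
  have hFm := hFc.aestronglyMeasurable (μ := ρ.prod ρ)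
  have hF0 : ∀ z : ℝ × ℝ, 0 < min (Real.exp (c * z.1)) (Real.exp (c * z.2)) := fun z =>
    lt_min (Real.exp_pos _) (Real.exp_pos _)
  have hle1 : ∀ z : ℝ × ℝ, ‖min (Real.exp (c * z.1)) (Real.exp (c * z.2))‖ ≤ Real.exp (c * z.1) :=
    fun z => by rw [Real.norm_eq_abs, abs_of_pos (hF0 z)]; exact min_le_left _ _
  have hle2 : ∀ z : ℝ × ℝ,
      ‖(min (Real.exp (c * z.1)) (Real.exp (c * z.2))) ^ 2‖ ≤ Real.exp (2 * c * z.1) := fun z => by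
    rw [Real.norm_eq_abs, abs_of_nonneg (sq_nonneg _),
      show Real.exp (2 * c * z.1) = Real.exp (c * z.1) ^ 2 by rw [← Real.exp_nat_mul]; ring_nf]
    exact pow_le_pow_left₀ (hF0 z).le (min_le_left _ _) 2
  have hI1 : Integrable (fun z : ℝ × ℝ => Real.exp (c * z.1)) (ρ.prod ρ) := h1.comp_fst ρ
  have hI2 : Integrable (fun z : ℝ × ℝ => Real.exp (2 * c * z.1)) (ρ.prod ρ) := h2.comp_fst ρ
  have hint : Integrable (fun z : ℝ × ℝ => min (Real.exp (c * z.1)) (Real.exp (c * z.2))) (ρ.prod ρ) :=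
    hI1.mono' hFm (Filter.Eventually.of_forall hle1)
  have hint2 : Integrable (fun z : ℝ × ℝ => (min (Real.exp (c * z.1)) (Real.exp (c * z.2))) ^ 2)
      (ρ.prod ρ) :=
    hI2.mono' (hFm.pow 2) (Filter.Eventually.of_forall hle2)
  refine ⟨hint, (memLp_two_iff_integrable_sq hFm).2 hint2, ?_⟩
  calc ∫ z, (min (Real.exp (c * z.1)) (Real.exp (c * z.2))) ^ 2 ∂(ρ.prod ρ)
      ≤ ∫ z : ℝ × ℝ, Real.exp (2 * c * z.1) ∂(ρ.prod ρ) :=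
        integral_mono_of_nonneg (Filter.Eventually.of_forall fun z => sq_nonneg _) hI2
          (Filter.Eventually.of_forall fun z => (le_abs_self _).trans
            (by simpa only [Real.norm_eq_abs] using hle2 z))
    _ = ∫ u, Real.exp (2 * c * u) ∂ρ := by
        rw [integral_fun_fst (fun u : ℝ => Real.exp (2 * c * u))]
        simp

/-- The pair functional as an iterated integral over the law of a statistic. [ours] -/
theorem integral_integral_min_exp_eq_integral_prod_map {Ω : Type*} {mΩ : MeasurableSpace Ω}
    (P : Measure Ω) [IsProbabilityMeasure P] {S : Ω → ℝ} (hS : Measurable S) (c : ℝ)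
    (h1 : Integrable (fun u => Real.exp (c * u)) (P.map S))
    (h2 : Integrable (fun u => Real.exp (2 * c * u)) (P.map S)) :
    ∫ x, ∫ y, min (Real.exp (c * S x)) (Real.exp (c * S y)) ∂P ∂P
      = ∫ z, min (Real.exp (c * z.1)) (Real.exp (c * z.2)) ∂((P.map S).prod (P.map S)) := by
  haveI : IsProbabilityMeasure (P.map S) := Measure.isProbabilityMeasure_map hS.aemeasurable
  obtain ⟨hint, -, -⟩ := min_exp_prod_facts (P.map S) c h1 h2
  rw [integral_prod _ hint]
  have hFc : Continuous fun z : ℝ × ℝ => min (Real.exp (c * z.1)) (Real.exp (c * z.2)) := by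
    fun_prop
  rw [integral_map hS.aemeasurable]
  · refine integral_congr_ae (Filter.Eventually.of_forall fun x => ?_)
    simp only
    rw [integral_map hS.aemeasurable]
    exact (hFc.comp (Continuous.prodMk_right (S x))).aestronglyMeasurable
  · -- measurability of the inner integral as a function of the outer variable
    have := (hint.integral_prod_left).aestronglyMeasurable
    exact this

end PairFunctional

/-! ## §3 The diagonal limit -/

section Diagonal

open Literature.Probability.Distributions.PseudoMarginalNoise

variable {X : Type*} {mX : MeasurableSpace X} {ν : Measure X} [IsProbabilityMeasure ν] {g : X → ℝ}

/-- The normalised row sum of a bounded block statistic is bounded: `|Σᵢ g(xᵢ)|/√n ≤ √n·K`. [ours] -/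
theorem pi_inv_sqrt_mul_sum_mem_Icc {K : ℝ} (hK : ∀ x, |g x| ≤ K) (n : ℕ) (y : Fin n → X) :
    (Real.sqrt n)⁻¹ * ∑ i, g (y i) ∈ Set.Icc (-(Real.sqrt n * K)) (Real.sqrt n * K) := by
  have hs : |∑ i, g (y i)| ≤ n * K := by
    calc |∑ i, g (y i)| ≤ ∑ i, |g (y i)| := Finset.abs_sum_le_sum_abs _ _
      _ ≤ ∑ _i : Fin n, K := Finset.sum_le_sum fun i _ => hK _
      _ = n * K := by simp
  have hn0 : 0 ≤ Real.sqrt n := Real.sqrt_nonneg _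
  have key : |(Real.sqrt n)⁻¹ * ∑ i, g (y i)| ≤ Real.sqrt n * K := by
    rw [abs_mul, abs_of_nonneg (inv_nonneg.2 hn0)]
    rcases Nat.eq_zero_or_pos n with hn | hn
    · subst hn; simp
    · have hsn : 0 < Real.sqrt n := Real.sqrt_pos.2 (Nat.cast_pos.2 hn)
      rw [inv_mul_le_iff₀ hsn, ← mul_assoc, Real.mul_self_sqrt (Nat.cast_nonneg n)]
      exact hs
  exact abs_le.1 key

/-- The partition function of the row: `∫ e^{t Σᵢ g(xᵢ)} dν^{⊗n} = M(t)^n`. [ours] -/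
theorem pi_integral_exp_mul_sum (hgm : Measurable g) (n : ℕ) (t : ℝ) :
    ∫ y, Real.exp (t * ∑ i, g (y i)) ∂(Measure.pi fun _ : Fin n => ν) = mgf g ν t ^ n := by
  have hind : iIndepFun (fun (i : Fin n) (y : Fin n → X) => g (y i)) (Measure.pi fun _ : Fin n => ν) :=
    iIndepFun_pi fun _ => hgm.aemeasurable
  have h := hind.mgf_sum (fun i => hgm.comp (measurable_pi_apply i)) Finset.univ (t := t)
  have e : (∑ i ∈ (Finset.univ : Finset (Fin n)), fun y : Fin n → X => g (y i))
      = fun y => ∑ i, g (y i) := by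
    funext y; simp [Finset.sum_apply]
  rw [e] at h
  have hmarg : ∀ i : Fin n, mgf (fun y : Fin n → X => g (y i)) (Measure.pi fun _ : Fin n => ν) t
      = mgf g ν t := fun i => by
    have hlaw := (measurePreserving_eval (fun _ : Fin n => ν) i).map_eq
    have hm := mgf_map (μ := Measure.pi fun _ : Fin n => ν) (Y := Function.eval i) (X := g)
      (measurable_pi_apply i).aemeasurable (t := t)
      (by rw [hlaw]; exact (Real.measurable_exp.comp (measurable_const.mul hgm)).aestronglyMeasurable)
    rw [hlaw] at hm
    rw [hm]
    rfl
  simp only [hmarg, Finset.prod_const, Finset.card_univ, Fintype.card_fin] at h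
  rw [← h]
  rfl

/-- Exponential moments of the law of the normalised row sum: `∫ e^{tu} dμₙ(u) = M(t/√n)^n`. [ours] -/
theorem pi_integral_exp_mul_map_inv_sqrt_mul_sum (hgm : Measurable g) (n : ℕ) (t : ℝ) :
    ∫ u, Real.exp (t * u) ∂((Measure.pi fun _ : Fin n => ν).map
        (fun y : Fin n → X => (Real.sqrt n)⁻¹ * ∑ i, g (y i)))
      = mgf g ν (t / Real.sqrt n) ^ n := by
  have hSm : Measurable fun y : Fin n → X => (Real.sqrt n)⁻¹ * ∑ i, g (y i) :=
    (Finset.measurable_sum _ fun i _ => hgm.comp (measurable_pi_apply i)).const_mul _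
  rw [integral_map hSm.aemeasurable (by fun_prop), ← pi_integral_exp_mul_sum hgm n (t / Real.sqrt n)]
  refine integral_congr_ae (Filter.Eventually.of_forall fun y => ?_)
  simp only
  congr 1
  ring

/-- **THE DIAGONAL SCALING LIMIT OF THE UNTRAINED FACTORISED SAMPLER.**  Bounded centred block
statistic `g` (`|g| ≤ K`, `∫ g dν = 0`, `σ² = Var g`), `n` i.i.d. blocks, coupling `β = c/√n`:
the equilibrium acceptance `(∫∫ min(e^{βT}, e^{βT′}) dν^{⊗n} dν^{⊗n}) / ∫ e^{βT} dν^{⊗n}` of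
proposals `ν^{⊗n}` against the tilt `e^{βT}ν^{⊗n}/M(β)^n`, `T = Σᵢ g(xᵢ)`, converges as `n → ∞` to
the LOG-NORMAL acceptance law `∫∫ min(e^x, e^y) dN(−s/2, s) dN(−s/2, s)`, `s = c²σ²`
(`noiseLaw s`). [ours] -/
theorem tiltPi_meanAccept_diag_tendsto (hgm : Measurable g) {K : ℝ} (hK : ∀ x, |g x| ≤ K)
    (h0 : ∫ x, g x ∂ν = 0) (c : ℝ) :
    Tendsto (fun n : ℕ =>
        (∫ x, ∫ y, min (Real.exp (c / Real.sqrt n * ∑ i, g (x i)))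
              (Real.exp (c / Real.sqrt n * ∑ i, g (y i)))
            ∂(Measure.pi fun _ : Fin n => ν) ∂(Measure.pi fun _ : Fin n => ν))
          / ∫ x, Real.exp (c / Real.sqrt n * ∑ i, g (x i)) ∂(Measure.pi fun _ : Fin n => ν))
      atTop (𝓝 (∫ x, ∫ y, min (Real.exp x) (Real.exp y)
        ∂(noiseLaw (c ^ 2 * Var[g; ν]).toNNReal) ∂(noiseLaw (c ^ 2 * Var[g; ν]).toNNReal))) := by
  -- basic facts on `g`
  set v : ℝ := Var[g; ν] with hv
  have hv0 : 0 ≤ v := variance_nonneg _ _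
  have hga : AEMeasurable g ν := hgm.aemeasurable
  have hgb : ∀ᵐ x ∂ν, g x ∈ Set.Icc (-K) K := ae_of_all _ fun x => abs_le.1 (hK x)
  have hgi : Integrable g ν := Integrable.of_mem_Icc (-K) K hga hgb
  have hg2 : MemLp g 2 ν :=
    (memLp_of_bounded hgb hga.aestronglyMeasurable 2)
  have hvK : v ≤ K ^ 2 := by
    have := variance_le_sq_of_bounded hgb hga
    rw [hv]; convert this using 1; ring
  -- the rows
  set P : (n : ℕ) → Measure (Fin n → X) := fun n => Measure.pi fun _ : Fin n => ν with hP
  set S : (n : ℕ) → (Fin n → X) → ℝ := fun n y => (Real.sqrt n)⁻¹ * ∑ i, g (y i) with hS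
  have hSm : ∀ n, Measurable (S n) := fun n =>
    (Finset.measurable_sum _ fun i _ => hgm.comp (measurable_pi_apply i)).const_mul _
  -- the laws `μₙ` of `Sₙ` and the Gaussian limit law
  haveI hPn : ∀ n, IsProbabilityMeasure ((P n).map (S n)) := fun n =>
    Measure.isProbabilityMeasure_map (hSm n).aemeasurable
  set μs : ℕ → ProbabilityMeasure ℝ := fun n => ⟨(P n).map (S n), hPn n⟩ with hμs
  set μ : ProbabilityMeasure ℝ := ⟨gaussianReal 0 v.toNNReal, inferInstance⟩ with hμ
  -- (1) the central limit theorem for the rows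
  have hclt : Tendsto μs atTop (𝓝 μ) := by
    have hZ : HasLaw (id : ℝ → ℝ) (gaussianReal 0 v.toNNReal) (gaussianReal 0 v.toNNReal) :=
      ⟨aemeasurable_id, Measure.map_id⟩
    have h := (pi_tendstoInDistribution_inv_sqrt_mul_sum (P' := gaussianReal 0 v.toNNReal)
      hg2 h0 hZ).tendsto
    simp only [Measure.map_id] at h
    convert h using 1
  -- exponential integrability of the laws
  have hexp : ∀ n (t : ℝ), Integrable (fun u => Real.exp (t * u)) ((μs n : Measure ℝ)) := by
    intro n t
    have hae : ∀ᵐ u ∂((P n).map (S n)), u ∈ Set.Icc (-(Real.sqrt n * K)) (Real.sqrt n * K) :=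
      (ae_map_iff (hSm n).aemeasurable
        (p := fun u => u ∈ Set.Icc (-(Real.sqrt n * K)) (Real.sqrt n * K)) measurableSet_Icc).2
        (ae_of_all _ fun y => pi_inv_sqrt_mul_sum_mem_Icc hK n y)
    exact integrable_exp_mul_of_mem_Icc (X := id) aemeasurable_id hae
  have hexpP : ∀ n (t : ℝ), Integrable (fun u => Real.exp (t * u)) ((P n).map (S n)) :=
    fun n t => hexp n t
  have hexpG : ∀ t : ℝ, Integrable (fun u => Real.exp (t * u)) (μ : Measure ℝ) := fun t => by
    change Integrable (fun u => Real.exp (t * id u)) (gaussianReal 0 v.toNNReal)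
    exact (integrable_exp_mul_gaussianReal (μ := 0) (v := v.toNNReal) t)
  -- (2) the numerator
  set C : ℝ := Real.exp ((‖K - -K‖₊ / 2) ^ 2 * (2 * c) ^ 2 / 2) with hC
  have hnum : Tendsto (fun n => ∫ z, min (Real.exp (c * z.1)) (Real.exp (c * z.2))
        ∂(((μs n : Measure ℝ)).prod (μs n))) atTop
      (𝓝 (∫ z, min (Real.exp (c * z.1)) (Real.exp (c * z.2)) ∂((μ : Measure ℝ).prod μ))) := by
    refine tendsto_integral_prod_of_tendsto hclt (by fun_prop)
      (fun z => (lt_min (Real.exp_pos _) (Real.exp_pos _)).le) (C := C) ?_ ?_ ?_ ?_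
    · intro n
      exact (min_exp_prod_facts (μs n : Measure ℝ) c (hexp n c)
        (hexp n (2 * c))).2.1
    · intro n
      refine (min_exp_prod_facts (μs n : Measure ℝ) c (hexp n c)
        (hexp n (2 * c))).2.2.trans ?_
      change ∫ u, Real.exp (2 * c * u) ∂((P n).map (S n)) ≤ C
      rw [pi_integral_exp_mul_map_inv_sqrt_mul_sum hgm n (2 * c)]
      exact mgf_div_sqrt_pow_le hga hgb h0 (2 * c) n
    · exact (min_exp_prod_facts (μ : Measure ℝ) c (hexpG c)
        (hexpG (2 * c))).2.1
    · refine (min_exp_prod_facts (μ : Measure ℝ) c (hexpG c)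
        (hexpG (2 * c))).2.2.trans ?_
      change ∫ u, Real.exp (2 * c * u) ∂(gaussianReal 0 v.toNNReal) ≤ C
      have hm := mgf_gaussianReal (p := gaussianReal 0 v.toNNReal) (X := id) (μ := 0) (v := v.toNNReal)
        Measure.map_id (2 * c)
      simp only [mgf, id_eq] at hm
      rw [show (fun u : ℝ => Real.exp (2 * c * u)) = fun u => Real.exp ((2 * c) * u) from rfl, hm,
        Real.coe_toNNReal v hv0, hC]
      apply Real.exp_le_exp.2
      have h1 : (‖K - -K‖₊ : ℝ) / 2 = |K| := by
        rw [coe_nnnorm, Real.norm_eq_abs, sub_neg_eq_add, ← two_mul, abs_mul, abs_two]; ring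
      rw [h1, sq_abs, zero_mul, zero_add]
      nlinarith [sq_nonneg c]
  -- (3) the denominator
  have hden : Tendsto (fun n : ℕ => ∫ x, Real.exp (c / Real.sqrt n * ∑ i, g (x i)) ∂(P n)) atTop
      (𝓝 (Real.exp (c ^ 2 * v / 2))) := by
    have h := tendsto_mgf_div_sqrt_pow hga hgb h0 c
    refine h.congr fun n => ?_
    rw [pi_integral_exp_mul_sum hgm n]
  -- (4) assemble
  have hnum' : Tendsto (fun n : ℕ => ∫ x, ∫ y, min (Real.exp (c / Real.sqrt n * ∑ i, g (x i)))
        (Real.exp (c / Real.sqrt n * ∑ i, g (y i))) ∂(P n) ∂(P n)) atTop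
      (𝓝 (∫ z, min (Real.exp (c * z.1)) (Real.exp (c * z.2)) ∂((μ : Measure ℝ).prod μ))) := by
    refine hnum.congr fun n => ?_
    have e : ∀ x : Fin n → X, c / Real.sqrt n * ∑ i, g (x i) = c * S n x := fun x => by
      simp only [hS]; ring
    simp_rw [e]
    exact (integral_integral_min_exp_eq_integral_prod_map (P n) (hSm n) c (hexpP n c)
      (hexpP n (2 * c))).symm
  have hlim := hnum'.div hden (Real.exp_pos _).ne'
  -- (5) identify the limit with the log-normal acceptance law
  have hprodA : ∫ z, min (Real.exp (c * z.1)) (Real.exp (c * z.2)) ∂((μ : Measure ℝ).prod μ)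
      = ∫ x, ∫ y, min (Real.exp (c * x)) (Real.exp (c * y)) ∂(gaussianReal 0 v.toNNReal)
          ∂(gaussianReal 0 v.toNNReal) :=
    integral_prod _ (min_exp_prod_facts (μ : Measure ℝ) c (hexpG c) (hexpG (2 * c))).1
  rw [hprodA] at hlim
  set s : ℝ≥0 := (c ^ 2 * v).toNNReal with hs
  have hcv : 0 ≤ c ^ 2 * v := by positivity
  have hsR : (s : ℝ) = c ^ 2 * v := Real.coe_toNNReal _ hcv
  -- the log-normal law as an affine image of `N(0, v)`
  have hφ : noiseLaw s
      = (gaussianReal 0 v.toNNReal).map (fun u => c * u + (-(c ^ 2 * v / 2))) := by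
    rw [show (fun u : ℝ => c * u + (-(c ^ 2 * v / 2))) = (fun u => u + (-(c ^ 2 * v / 2))) ∘ (fun u => c * u)
        from rfl,
      ← Measure.map_map (measurable_add_const _) (measurable_const_mul c), gaussianReal_map_const_mul,
      gaussianReal_map_add_const, noiseLaw, hsR]
    congr 1
    · ring
    · ext
      push_cast
      rw [Real.coe_toNNReal _ hcv, Real.coe_toNNReal _ hv0]
  have hF2c : Continuous fun z : ℝ × ℝ => min (Real.exp z.1) (Real.exp z.2) := by fun_prop
  have hEq : (∫ x, ∫ y, min (Real.exp (c * x)) (Real.exp (c * y)) ∂(gaussianReal 0 v.toNNReal)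
        ∂(gaussianReal 0 v.toNNReal)) / Real.exp (c ^ 2 * v / 2)
      = ∫ x, ∫ y, min (Real.exp x) (Real.exp y) ∂(noiseLaw s) ∂(noiseLaw s) := by
    rw [hφ, integral_map (by fun_prop)
      (hF2c.stronglyMeasurable.integral_prod_right').aestronglyMeasurable]
    have inner : ∀ x : ℝ, ∫ y, min (Real.exp x) (Real.exp y)
          ∂((gaussianReal 0 v.toNNReal).map (fun u => c * u + (-(c ^ 2 * v / 2))))
        = ∫ u, min (Real.exp x) (Real.exp (c * u + (-(c ^ 2 * v / 2)))) ∂(gaussianReal 0 v.toNNReal) :=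
      fun x => integral_map (by fun_prop) (by fun_prop)
    simp_rw [inner]
    have pt : ∀ u u' : ℝ, min (Real.exp (c * u + (-(c ^ 2 * v / 2)))) (Real.exp (c * u' + (-(c ^ 2 * v / 2))))
        = min (Real.exp (c * u)) (Real.exp (c * u')) * Real.exp (-(c ^ 2 * v / 2)) := fun u u' => by
      rw [Real.exp_add, Real.exp_add, min_mul_of_nonneg _ _ (Real.exp_pos _).le]
    simp_rw [pt, integral_mul_const]
    rw [Real.exp_neg, div_eq_mul_inv]
  rw [hEq] at hlim
  exact hlim

/-- **THE DIAGONAL PROFILE IS `erfc(|c|σ/2)`**: for `c ≠ 0` and a non-degenerate block statistic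
(`Var g ≠ 0`), `acc_n(c/√n) → (2/√π)∫_{√(c²σ²)/2}^∞ e^{−u²} du = erfc(|c|σ/2)` — the flow seat's
log-normal acceptance law `imh_lognormal_accRate_eq_erfc` at log-variance `s = c²σ²`. [ours] -/
theorem tiltPi_meanAccept_diag_tendsto_erfc (hgm : Measurable g) {K : ℝ} (hK : ∀ x, |g x| ≤ K)
    (h0 : ∫ x, g x ∂ν = 0) {c : ℝ} (hc : c ≠ 0) (hσ : Var[g; ν] ≠ 0) :
    Tendsto (fun n : ℕ =>
        (∫ x, ∫ y, min (Real.exp (c / Real.sqrt n * ∑ i, g (x i)))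
              (Real.exp (c / Real.sqrt n * ∑ i, g (y i)))
            ∂(Measure.pi fun _ : Fin n => ν) ∂(Measure.pi fun _ : Fin n => ν))
          / ∫ x, Real.exp (c / Real.sqrt n * ∑ i, g (x i)) ∂(Measure.pi fun _ : Fin n => ν))
      atTop (𝓝 (2 / Real.sqrt Real.pi
        * ∫ u in Ioi (Real.sqrt (c ^ 2 * Var[g; ν]) / 2), Real.exp (-u ^ 2))) := by
  have hpos : 0 < c ^ 2 * Var[g; ν] :=
    mul_pos (by positivity) (lt_of_le_of_ne (variance_nonneg _ _) (Ne.symm hσ))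
  have hs : (c ^ 2 * Var[g; ν]).toNNReal ≠ 0 := fun h =>
    absurd (Real.toNNReal_eq_zero.1 h) (not_le.2 hpos)
  have h := tiltPi_meanAccept_diag_tendsto hgm hK h0 c
  rw [Scoring.imh_lognormal_accRate_eq_erfc hs, Real.coe_toNNReal _ hpos.le] at h
  exact h

end Diagonal

end Summit.Ventures.LatticeQCDFlow.Theory2

end
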